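import Mathlib
import HarnessLib
import Literature.RingTheory.CohomologyAnnihilator.StrongGenerator
import Literature.RingTheory.CohomologyAnnihilator.SyzygyBasic
import Literature.RingTheory.CohomologyAnnihilator.TowerBasic

/-!
# Abstract hypersurface periodicity: over `T = R ⧸ (f)` (`f` a nonzerodivisor) every finitely
# generated `T`-module with `pd_R ≤ 1` is a SECOND SYZYGY OF ITSELF

Route `ResolutionOfSingularities/HomologicalConductor`, chain W4.4b, rung S-2 `PersistenceSurface`
(stmt-ResolutionOfSingularities-19970); o9 lineage, object o9f part 1/2 (res-L1-w44b-plan-1's Q9-1,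
ASSIGN v1.3 2026-08-27: the abstract form without a power basis).  [OURS · L1 w44b · res-type-011;
AI-written, weaker than expert review; NOT a statement of the manuscript under study, and no statement of
that manuscript is used.]

* `exists_one_tmul_eq`, `one_tmul_eq_zero_iff` — bookkeeping in `(R ⧸ (f)) ⊗_R F ≃ F ⧸ f F`
  (Mathlib `quotTensorEquivQuotSMul`);
* `exists_periodic_presentation_quotient` — for a `T`-module `K` and an `R`-surjection `p : F₀ ↠ K`
  from a FLAT `F₀` with kernel `F₁`: since `f K = 0`, `f • F₀ ⊆ F₁`, and with `φ = F₁ ↪ F₀`,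
  `ψ = f • : F₀ → F₁` one has `φψ = f = ψφ` (the matrix factorisation of `f` attached to `K`); reducing
  mod `f` gives `T`-linear `ι : K → T ⊗ F₁`, `τ = φ̄`, `μ : T ⊗ F₀ → K` with `ι` injective, `μ`
  surjective, `range ι = ker τ`, `range τ = ker μ`;
* `isSyzygy_two_self_quotient` — hence (`R` noetherian) every finitely generated `T`-module `K` with
  `HasProjectiveDimensionLT (K|_R) 2` is a second syzygy of itself, `IsSyzygy 2 K K`, with middle terms
  `T ⊗_R Rⁿ`, `T ⊗_R ker(Rⁿ ↠ K)`.
No power basis and no regularity of `R` are used here (compare o9a `HypersurfacePeriodicity`, which needs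
`B` free over a subring `S` with `K` projective over `S`).  Part 2/2
(`…QuotientHypersurfaceSaturation.lean`) adds dimension shifting and `ca(R ⧸ (f)) = caᵈ⁺¹(R ⧸ (f))`.
References (mechanism only): D. Eisenbud, Trans. AMS 260 (1980) §5–6.
-/

noncomputable section

-- single-problem summit: the doubled namespace component `ResolutionOfSingularities` is forced
set_option linter.dupNamespace false

namespace Summit.ResolutionOfSingularities.ResolutionOfSingularities.Theorems.HomologicalConductor.QuotientHypersurfacePeriodicity

open CategoryTheory TensorProduct Literature.RingTheory.CohomologyAnnihilator
open scoped TensorProduct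

universe u


variable {R : Type u} [CommRing R]

/-- Every element of `(R ⧸ I) ⊗_R F` is an elementary tensor `1 ⊗ x` (via Mathlib's
`quotTensorEquivQuotSMul : (R ⧸ I) ⊗ F ≃ F ⧸ I•F`). [folklore] -/
theorem exists_one_tmul_eq (I : Ideal R) (F : Type u) [AddCommGroup F] [Module R F]
    (w : (R ⧸ I) ⊗[R] F) : ∃ x : F, (1 : R ⧸ I) ⊗ₜ[R] x = w := by
  obtain ⟨x, hx⟩ := Submodule.Quotient.mk_surjective _ (TensorProduct.quotTensorEquivQuotSMul F I w)
  refine ⟨x, (TensorProduct.quotTensorEquivQuotSMul F I).injective ?_⟩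
  rw [TensorProduct.quotTensorEquivQuotSMul_mk_one_tmul, hx]

/-- In `(R ⧸ (f)) ⊗_R F`: `1 ⊗ x = 0` iff `x ∈ f • F`. [folklore] -/
theorem one_tmul_eq_zero_iff (f : R) (F : Type u) [AddCommGroup F] [Module R F] (x : F) :
    (1 : R ⧸ Ideal.span {f}) ⊗ₜ[R] x = 0 ↔ ∃ y : F, f • y = x := by
  rw [← (TensorProduct.quotTensorEquivQuotSMul F (Ideal.span {f})).map_eq_zero_iff,
    TensorProduct.quotTensorEquivQuotSMul_mk_one_tmul, Submodule.Quotient.mk_eq_zero,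
    Submodule.ideal_span_singleton_smul, Submodule.mem_smul_pointwise_iff_exists]
  simp

/-- **The periodic presentation over an abstract hypersurface ring `T = R ⧸ (f)`** (`f` a
nonzerodivisor). Let `K` be a `T`-module and `p : F₀ ↠ K` an `R`-linear surjection from a FLAT
`R`-module with kernel `F₁ = ker p` (so `pd_R K ≤ 1` when `F₁` is projective). Since `f K = 0`,
`f • F₀ ⊆ F₁`: with `φ : F₁ ↪ F₀` the inclusion and `ψ : F₀ → F₁`, `y ↦ f • y`, one has
`φ ψ = f = ψ φ` — the MATRIX FACTORISATION of `f` attached to `K` — and reducing mod `f`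
(`P_i = T ⊗_R F_i`, every element `1 ⊗ x`, `1 ⊗ x = 0 ⟺ x ∈ f F_i`, `f` regular on the flat `F₀`)
gives `T`-linear `ι : K → P₁`, `τ = φ̄ : P₁ → P₀`, `μ : P₀ → K` with `ι` injective, `μ` surjective,
`range ι = ker τ` (`= range ψ̄`), `range τ = ker μ`: the exact sequences `0 → ker μ → P₀ → K → 0` and
`0 → K → P₁ → ker μ → 0`.  No power basis, no regularity of `R` is used here.
[OURS; mechanism: Eisenbud 1980, §5–6] -/
theorem exists_periodic_presentation_quotient (f : R) (hf : f ∈ nonZeroDivisors R)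
    (K : Type u) [AddCommGroup K] [Module (R ⧸ Ideal.span {f}) K] [Module R K]
    [IsScalarTower R (R ⧸ Ideal.span {f}) K]
    (F₀ : Type u) [AddCommGroup F₀] [Module R F₀] [Module.Flat R F₀]
    (p : F₀ →ₗ[R] K) (hp : Function.Surjective p) :
    ∃ (ι : K →ₗ[R ⧸ Ideal.span {f}] (R ⧸ Ideal.span {f}) ⊗[R] (LinearMap.ker p))
      (τ : (R ⧸ Ideal.span {f}) ⊗[R] (LinearMap.ker p) →ₗ[R ⧸ Ideal.span {f}]
        (R ⧸ Ideal.span {f}) ⊗[R] F₀)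
      (μ : (R ⧸ Ideal.span {f}) ⊗[R] F₀ →ₗ[R ⧸ Ideal.span {f}] K),
      Function.Injective ι ∧ Function.Surjective μ ∧
        LinearMap.range ι = LinearMap.ker τ ∧ LinearMap.range τ = LinearMap.ker μ := by
  -- `f` kills `K`
  have hf0 : algebraMap R (R ⧸ Ideal.span {f}) f = 0 :=
    Ideal.Quotient.eq_zero_iff_mem.mpr (Ideal.subset_span rfl)
  have hfK : ∀ m : K, f • m = 0 := fun m => by
    rw [← algebraMap_smul (R ⧸ Ideal.span {f}) f m, hf0, zero_smul]
  -- `φ` = inclusion of `F₁ = ker p`, `ψ` = multiplication by `f` landing in `F₁`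
  let φ : LinearMap.ker p →ₗ[R] F₀ := (LinearMap.ker p).subtype
  have hψmem : ∀ y : F₀, f • y ∈ LinearMap.ker p := fun y => by
    rw [LinearMap.mem_ker, map_smul, hfK]
  let ψ : F₀ →ₗ[R] LinearMap.ker p :=
    LinearMap.codRestrict (LinearMap.ker p) (f • LinearMap.id) (fun y => hψmem y)
  have hψ : ∀ y : F₀, (ψ y : F₀) = f • y := fun y => rfl
  have hψφ : ∀ x : LinearMap.ker p, ψ (x : F₀) = f • x := fun x => Subtype.ext rfl
  -- `f` is regular on the flat module `F₀`
  have hreg : ∀ y : F₀, f • y = 0 → y = 0 := fun y hy =>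
    (Module.Flat.isSMulRegular_of_nonZeroDivisors (M := F₀) hf)
      (show f • y = f • (0 : F₀) by rw [hy, smul_zero])
  -- base change to `T = R ⧸ (f)`
  let φb : (R ⧸ Ideal.span {f}) ⊗[R] (LinearMap.ker p) →ₗ[R ⧸ Ideal.span {f}]
      (R ⧸ Ideal.span {f}) ⊗[R] F₀ := φ.baseChange (R ⧸ Ideal.span {f})
  let ψb : (R ⧸ Ideal.span {f}) ⊗[R] F₀ →ₗ[R ⧸ Ideal.span {f}]
      (R ⧸ Ideal.span {f}) ⊗[R] (LinearMap.ker p) := ψ.baseChange (R ⧸ Ideal.span {f})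
  let μ : (R ⧸ Ideal.span {f}) ⊗[R] F₀ →ₗ[R ⧸ Ideal.span {f}] K :=
    p.liftBaseChange (R ⧸ Ideal.span {f})
  have hφb : ∀ x : LinearMap.ker p,
      φb ((1 : R ⧸ Ideal.span {f}) ⊗ₜ[R] x) = (1 : R ⧸ Ideal.span {f}) ⊗ₜ[R] (x : F₀) :=
    fun x => LinearMap.baseChange_tmul _ _ _
  have hψb : ∀ y : F₀,
      ψb ((1 : R ⧸ Ideal.span {f}) ⊗ₜ[R] y) = (1 : R ⧸ Ideal.span {f}) ⊗ₜ[R] ψ y :=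
    fun y => LinearMap.baseChange_tmul _ _ _
  have hμ : ∀ y : F₀, μ ((1 : R ⧸ Ideal.span {f}) ⊗ₜ[R] y) = p y := fun y =>
    (LinearMap.liftBaseChange_tmul (R ⧸ Ideal.span {f}) p 1 y).trans (one_smul _ _)
  -- (a) `range φb = ker μ`
  have hφμ : LinearMap.range φb = LinearMap.ker μ := by
    apply le_antisymm
    · rintro _ ⟨w, rfl⟩
      obtain ⟨x, rfl⟩ := exists_one_tmul_eq (Ideal.span {f}) (LinearMap.ker p) w
      rw [LinearMap.mem_ker, hφb, hμ]
      exact x.2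
    · intro w hw
      obtain ⟨y, rfl⟩ := exists_one_tmul_eq (Ideal.span {f}) F₀ w
      rw [LinearMap.mem_ker, hμ] at hw
      exact ⟨(1 : R ⧸ Ideal.span {f}) ⊗ₜ[R] (⟨y, hw⟩ : LinearMap.ker p), hφb _⟩
  -- (b) `range ψb = ker φb`
  have hψφ' : LinearMap.range ψb = LinearMap.ker φb := by
    apply le_antisymm
    · rintro _ ⟨w, rfl⟩
      obtain ⟨y, rfl⟩ := exists_one_tmul_eq (Ideal.span {f}) F₀ w
      rw [LinearMap.mem_ker, hψb, hφb, hψ]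
      exact (one_tmul_eq_zero_iff f F₀ _).mpr ⟨y, rfl⟩
    · intro w hw
      obtain ⟨x, rfl⟩ := exists_one_tmul_eq (Ideal.span {f}) (LinearMap.ker p) w
      rw [LinearMap.mem_ker, hφb, one_tmul_eq_zero_iff] at hw
      obtain ⟨y, hy⟩ := hw
      refine ⟨(1 : R ⧸ Ideal.span {f}) ⊗ₜ[R] y, ?_⟩
      rw [hψb]
      congr 1
      exact Subtype.ext (by rw [hψ, hy])
  -- (c) `range φb = ker ψb`
  have hφψ' : LinearMap.range φb = LinearMap.ker ψb := by
    apply le_antisymm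
    · rintro _ ⟨w, rfl⟩
      obtain ⟨x, rfl⟩ := exists_one_tmul_eq (Ideal.span {f}) (LinearMap.ker p) w
      rw [LinearMap.mem_ker, hφb, hψb, hψφ]
      exact (one_tmul_eq_zero_iff f (LinearMap.ker p) _).mpr ⟨x, rfl⟩
    · intro w hw
      obtain ⟨y, rfl⟩ := exists_one_tmul_eq (Ideal.span {f}) F₀ w
      rw [LinearMap.mem_ker, hψb, one_tmul_eq_zero_iff] at hw
      obtain ⟨x, hx⟩ := hw
      -- `f • x = ψ y` in `F₁`, i.e. `f • (x : F₀) = f • y`, so `y = x`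
      have hxy : (x : F₀) = y := by
        have h1 : f • ((x : F₀) - y) = 0 := by
          rw [smul_sub, sub_eq_zero, ← hψ y, ← hx]
          rfl
        exact sub_eq_zero.mp (hreg _ h1)
      exact ⟨(1 : R ⧸ Ideal.span {f}) ⊗ₜ[R] x, by rw [hφb, hxy]⟩
  -- `μ` surjective
  have hμsurj : Function.Surjective μ := fun m => by
    obtain ⟨y, rfl⟩ := hp m
    exact ⟨(1 : R ⧸ Ideal.span {f}) ⊗ₜ[R] y, hμ y⟩
  -- `ι` : `K ≅ P₀ / ker μ → P₁` induced by `ψb` (`ker μ = range φb = ker ψb`)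
  have hker : LinearMap.ker μ ≤ LinearMap.ker ψb := by rw [← hφμ, hφψ']
  let ψq : ((R ⧸ Ideal.span {f}) ⊗[R] F₀ ⧸ LinearMap.ker μ) →ₗ[R ⧸ Ideal.span {f}]
      (R ⧸ Ideal.span {f}) ⊗[R] (LinearMap.ker p) := (LinearMap.ker μ).liftQ ψb hker
  let ι : K →ₗ[R ⧸ Ideal.span {f}] (R ⧸ Ideal.span {f}) ⊗[R] (LinearMap.ker p) :=
    ψq ∘ₗ (μ.quotKerEquivOfSurjective hμsurj).symm.toLinearMap
  refine ⟨ι, φb, μ, ?_, hμsurj, ?_, hφμ⟩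
  · -- injective
    have hψq : Function.Injective ψq := by
      rw [← LinearMap.ker_eq_bot]
      exact Submodule.ker_liftQ_eq_bot _ _ _ (by rw [← hφψ', hφμ])
    exact hψq.comp (μ.quotKerEquivOfSurjective hμsurj).symm.injective
  · -- `range ι = ker φb`
    rw [← hψφ', LinearMap.range_comp, LinearEquiv.range, Submodule.map_top, Submodule.range_liftQ]

/-- **Abstract hypersurface periodicity (`IsSyzygy` form).** Over `T = R ⧸ (f)` (`R` noetherian, `f` a
nonzerodivisor), every finitely generated `T`-module `K` with `pd_R K ≤ 1`
(`HasProjectiveDimensionLT (K|_R) 2`) is a second syzygy of itself: `IsSyzygy 2 K K`, with middle terms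
`T ⊗_R Rⁿ` and `T ⊗_R ker(Rⁿ ↠ K)` (finitely generated projective over `T`). [OURS] -/
theorem isSyzygy_two_self_quotient [IsNoetherianRing R] (f : R) (hf : f ∈ nonZeroDivisors R)
    (K : ModuleCat.{u} (R ⧸ Ideal.span {f})) [Module R K]
    [IsScalarTower R (R ⧸ Ideal.span {f}) K] [Module.Finite (R ⧸ Ideal.span {f}) K]
    (hpd : HasProjectiveDimensionLT (ModuleCat.of R K) 2) : IsSyzygy 2 K K := by
  haveI : Module.Finite R (R ⧸ Ideal.span {f}) :=
    Module.Finite.of_surjective (Algebra.linearMap R (R ⧸ Ideal.span {f})) Ideal.Quotient.mk_surjective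
  haveI : Module.Finite R K := Module.Finite.trans (R ⧸ Ideal.span {f}) K
  obtain ⟨n, p, hp⟩ := Module.Finite.exists_fin' R K
  -- `ker p` is projective over `R` since `pd_R K ≤ 1`
  obtain ⟨w₀, hS₀⟩ := exists_shortExact_of_linearMap (Y := ModuleCat.of R (LinearMap.ker p))
    (M := ModuleCat.of R (Fin n → R)) (X := ModuleCat.of R K) (LinearMap.ker p).subtype p
    Subtype.val_injective hp (LinearMap.exact_subtype_ker_map p)
  haveI : Projective (ModuleCat.of R (Fin n → R)) :=
    (IsProjective.iff_projective (R := R) (Fin n → R)).mp inferInstance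
  have hK1 : HasProjectiveDimensionLT (ModuleCat.of R (LinearMap.ker p)) 1 :=
    hS₀.hasProjectiveDimensionLT_X₁ 1 inferInstance hpd
  haveI : Module.Projective R (LinearMap.ker p) :=
    (IsProjective.iff_projective (R := R) (LinearMap.ker p)).mpr
      (projective_iff_hasProjectiveDimensionLT_one.mpr hK1)
  -- the periodic presentation
  obtain ⟨ι, τ, μ, hι, hμ, hιτ, hτμ⟩ :=
    exists_periodic_presentation_quotient f hf K (Fin n → R) p hp
  let P₀ : ModuleCat.{u} (R ⧸ Ideal.span {f}) :=
    ModuleCat.of (R ⧸ Ideal.span {f}) ((R ⧸ Ideal.span {f}) ⊗[R] (Fin n → R))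
  let P₁ : ModuleCat.{u} (R ⧸ Ideal.span {f}) :=
    ModuleCat.of (R ⧸ Ideal.span {f}) ((R ⧸ Ideal.span {f}) ⊗[R] (LinearMap.ker p))
  have hP₀fin : Module.Finite (R ⧸ Ideal.span {f}) P₀ :=
    inferInstanceAs (Module.Finite (R ⧸ Ideal.span {f}) ((R ⧸ Ideal.span {f}) ⊗[R] (Fin n → R)))
  have hP₁fin : Module.Finite (R ⧸ Ideal.span {f}) P₁ :=
    inferInstanceAs (Module.Finite (R ⧸ Ideal.span {f}) ((R ⧸ Ideal.span {f}) ⊗[R] (LinearMap.ker p)))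
  have hP₀proj : Projective P₀ :=
    (IsProjective.iff_projective (R := R ⧸ Ideal.span {f})
      ((R ⧸ Ideal.span {f}) ⊗[R] (Fin n → R))).mp inferInstance
  have hP₁proj : Projective P₁ :=
    (IsProjective.iff_projective (R := R ⧸ Ideal.span {f})
      ((R ⧸ Ideal.span {f}) ⊗[R] (LinearMap.ker p))).mp inferInstance
  let K₁ : ModuleCat.{u} (R ⧸ Ideal.span {f}) := ModuleCat.of (R ⧸ Ideal.span {f}) (LinearMap.ker μ)
  -- `0 → K₁ → P₀ → K → 0`
  obtain ⟨w₁, hS₁⟩ := exists_shortExact_of_linearMap (Y := K₁) (M := P₀) (X := K)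
    (LinearMap.ker μ).subtype μ Subtype.val_injective hμ (LinearMap.exact_subtype_ker_map μ)
  -- `0 → K → P₁ → K₁ → 0`
  have hτmem : ∀ v, τ v ∈ LinearMap.ker μ := fun v => hτμ ▸ LinearMap.mem_range_self τ v
  let τ' : ((R ⧸ Ideal.span {f}) ⊗[R] (LinearMap.ker p)) →ₗ[R ⧸ Ideal.span {f}] LinearMap.ker μ :=
    LinearMap.codRestrict _ τ hτmem
  have hτ' : Function.Surjective τ' := by
    rintro ⟨w, hw⟩
    rw [← hτμ] at hw
    obtain ⟨v, rfl⟩ := hw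
    exact ⟨v, rfl⟩
  have hexact : Function.Exact ι τ' := by
    intro v
    constructor
    · intro hv
      have hv' : τ v = 0 := congrArg Subtype.val hv
      have : v ∈ LinearMap.range ι := by rw [hιτ]; exact hv'
      obtain ⟨m, rfl⟩ := this
      exact ⟨m, rfl⟩
    · rintro ⟨m, rfl⟩
      apply Subtype.ext
      have : ι m ∈ LinearMap.ker τ := hιτ ▸ LinearMap.mem_range_self ι m
      exact this
  obtain ⟨w₂, hS₂⟩ := exists_shortExact_of_linearMap (Y := K) (M := P₁) (X := K₁) ι τ' hι hτ'
    hexact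
  exact ⟨K₁, P₁, ⟨K, P₀, ⟨Iso.refl K⟩, hP₀fin, hP₀proj, _, _, w₁, hS₁⟩, hP₁fin, hP₁proj, _, _,
    w₂, hS₂⟩


end Summit.ResolutionOfSingularities.ResolutionOfSingularities.Theorems.HomologicalConductor.QuotientHypersurfacePeriodicity

end
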